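import Summits.QuantumFields.YangMills.Theorems.F4SubCurvatureDoorFibreDichotomyAxisRungs
import Mathlib
import HarnessLib

/-!
# LINE g21-B «fibre dichotomy» (crux ⟨stmt-QuantumFields-23125⟩): RP two-point domination `|K̃(x)| ≤ L_ν(‖x‖/√2)`

Free-hands helper of width seat `ym-line-sfw-p2-w3` (g37, cell `ym-idea-1`).  The card of LINE g21-B (stub B4 `SingleShellDichotomy`) uses the
«RP two-point domination `|K̃(x)| ≤ L_ν(‖x‖/√2)`» for an LF-symmetric cone-carried fibre measure; it is the composition of the two landed
rungs R-B4c `axisDomination_holds` and R-B4d `shortRootCovering_holds` (✓ `F4SubCurvatureDoorFibreDichotomyAxisRungs`) with the monotonicity of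
the axis function `t ↦ ∫ e^{−tE} dν` on a measure carried by `{E ≥ ‖q⃗‖}`.  `SymmetricLF` is restated CHARACTER-FOR-CHARACTER from
`Cruxes/RationalToGeneral/Lines/fibre_dichotomy.lean`.

* `lfEval_timeSpace_zero` — `lfEval ν (t, 0⃗) = ∫ e^{−|t|E} dν`;
* `lfEval_axis_antitone` — the axis function is non-increasing in `t > 0` on cone-carried measures;
* `abs_lfEval_le_axis_of_symmetricLF` — **`|lfEval ν x| ≤ lfEval ν (‖x‖/√2, 0⃗)`** for `x₀ ≠ 0`.

HONEST LABEL: a helper toward an OPEN stub (B4); nothing of B4/B5/⟨23125⟩/⟨23035⟩/R2d is proved; the Yang–Mills mass gap is NOT proved.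
-/

set_option autoImplicit false

noncomputable section

namespace Summit.QuantumFields.YangMills.Theorems.F4SubCurvatureDoorFibreDichotomyAxis

open scoped BigOperators
open MeasureTheory Set
open Summit.QuantumFields.YangMills.Theorems.F4SubCurvatureDoorLaplaceFourierRegistered (E4 E3 timeSpace)

/-- A measure is LF-SYMMETRIC: its Laplace–Fourier evaluation is `W(F₄)`-invariant at all points where both times are non-zero
(verbatim from the skeleton `fibre_dichotomy.lean`). -/
def SymmetricLF (ν : Measure (ℝ × E3)) : Prop :=
  ∀ R : E4 ≃ₗᵢ[ℝ] E4, IsD4Isometry R → ∀ x : E4, x 0 ≠ 0 → (R x) 0 ≠ 0 → lfEval ν (R x) = lfEval ν x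

/-- The axis value of `lfEval`: `lfEval ν (t, 0⃗) = ∫ e^{−|t|E} dν`. -/
theorem lfEval_timeSpace_zero (ν : Measure (ℝ × E3)) (t : ℝ) :
    lfEval ν (timeSpace t 0) = ∫ p : ℝ × E3, Real.exp (-(|t| * p.1)) ∂ν := by
  rw [lfEval, spacePart_timeSpace, timeSpace_zero]
  simp only [inner_zero_right, Real.cos_zero, mul_one]

/-- **Monotonicity of the axis function**: on a measure carried by the closed forward cone `{E ≥ ‖q⃗‖}` (so `E ≥ 0` a.e.) and
Laplace-integrable, `t ↦ ∫ e^{−tE} dν` is non-increasing on `t > 0`. -/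
theorem lfEval_axis_antitone {ν : Measure (ℝ × E3)} (hcone : ν {p | p.1 < ‖p.2‖} = 0)
    (hint : ∀ t : ℝ, 0 < t → Integrable (fun p : ℝ × E3 => Real.exp (-(t * p.1))) ν)
    {t t' : ℝ} (ht : 0 < t) (htt' : t ≤ t') :
    lfEval ν (timeSpace t' 0) ≤ lfEval ν (timeSpace t 0) := by
  have ht' : 0 < t' := lt_of_lt_of_le ht htt'
  rw [lfEval_timeSpace_zero, lfEval_timeSpace_zero, abs_of_pos ht, abs_of_pos ht']
  refine integral_mono_ae (hint t' ht') (hint t ht) ?_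
  have hae : ∀ᵐ p ∂ν, ¬ (p.1 < ‖p.2‖) := by
    rw [ae_iff]
    simpa using hcone
  filter_upwards [hae] with p hp
  have hE : 0 ≤ p.1 := le_trans (norm_nonneg _) (not_lt.1 hp)
  exact Real.exp_le_exp.2 (by nlinarith)

/-- **RP two-point domination**: for an LF-symmetric measure carried by the closed forward cone and Laplace-integrable,
`|lfEval ν x| ≤ lfEval ν (‖x‖/√2, 0⃗)` at every point with `x₀ ≠ 0` — move `x` by a `D₄`-isometry so that its time component is
`≥ ‖x‖/√2` (`shortRootCovering_holds`), bound by the axis value (`axisDomination_holds`), and use monotonicity of the axis function. -/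
theorem abs_lfEval_le_axis_of_symmetricLF {ν : Measure (ℝ × E3)} (hS : SymmetricLF ν) (hcone : ν {p | p.1 < ‖p.2‖} = 0)
    (hint : ∀ t : ℝ, 0 < t → Integrable (fun p : ℝ × E3 => Real.exp (-(t * p.1))) ν) (x : E4) (hx : x 0 ≠ 0) :
    |lfEval ν x| ≤ lfEval ν (timeSpace (‖x‖ / Real.sqrt 2) 0) := by
  obtain ⟨R, hR, hRx⟩ := shortRootCovering_holds x
  have hxne : x ≠ 0 := fun h => hx (by rw [h]; rfl)
  have hpos : 0 < ‖x‖ / Real.sqrt 2 := div_pos (norm_pos_iff.2 hxne) (by positivity)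
  have hR0 : (R x) 0 ≠ 0 := fun h => by rw [h, abs_zero] at hRx; linarith
  rw [← hS R hR x hx hR0]
  calc |lfEval ν (R x)| ≤ lfEval ν (timeSpace |(R x) 0| 0) := axisDomination_holds ν (R x) hR0 hint
    _ ≤ lfEval ν (timeSpace (‖x‖ / Real.sqrt 2) 0) := lfEval_axis_antitone hcone hint hpos hRx

end Summit.QuantumFields.YangMills.Theorems.F4SubCurvatureDoorFibreDichotomyAxis

end
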